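import Summits.Ventures.Crystal3D.Theorems.StickyWulffConstantCoaxialWallLawTriadicCore
import Summits.Ventures.Crystal3D.Theorems.StickyWulffConstantCoaxialWallLawOfCensus
import Summits.Ventures.Crystal3D.Theorems.StickyWulffConstantGenericWallFloorOfP5Exhaustion
import HarnessLib

/-!
# Capstone: `CoaxialWallLaw` BY NAME ⇐ {E1, `StarPairFar`, the triadic core} (crux `CoaxialWallLaw`, stmt-Ventures-19481,
# line `WallLedgerF`)

HONEST FRAMING. Venture `Summits/Ventures/Crystal3D` (cell `crystal3d-full`), helper `--supports` the crux
`CoaxialWallLaw` of `route-Ventures-StickyWulffConstant` (REGISTERED line `WallLedgerF`).  LEAF capstone (imports the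
route file through `…CoaxialWallLawOfCensus` for the skeleton composition `coaxialWallLaw_of_stubProps`; nothing should
import this file).  Book-keeping only; F-C1 not moved; NOT the crux: the triadic core `CoaxialTwoSlabAdhesionTriadic`
(`…TriadicCore`) is open, `ExactOnly`(C12-55) / `P5Exhaustion` [E1, certified] and `StarPairFar` [certified; kernel at
computational grade] are inputs BY NAME.

* **`coaxialWallLaw_of_triadic`** — `ExactOnly`(C12-55) + `StarPairFar` + `CoaxialTwoSlabAdhesionTriadic` ⇒
  `Summit.Ventures.Crystal3D.Theses.StickyWulffConstant.CoaxialWallLaw`;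
* **`coaxialWallLaw_of_p5_triadic`** — the same keyed to `P5Exhaustion`.
WHAT THIS IS NOT: a proof of the core; F-C1 not moved.
-/

noncomputable section

namespace Summit.Ventures.Crystal3D.Theorems

open Summit.Ventures.Crystal3D Finset
open Summit.Ventures.Crystal3D.Cruxes.CoaxialWallLaw.WallLedgerF (AffineSampleDeficit CoaxialTwoSlabAdhesion)
open Literature.MathematicalPhysics.StatisticalMechanics (fccStacking barlowStacking IsHaggSeq contactDeficiency)
open scoped InnerProductSpace

open scoped Classical in
/-- **The crux `CoaxialWallLaw` BY NAME from `ExactOnly`(C12-55), `StarPairFar` and the triadic core** (skeleton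
composition `coaxialWallLaw_of_stubProps` with the landed `stub_affineSampleDeficit`). -/
theorem coaxialWallLaw_of_triadic
    {s₀ : EuclideanSpace ℝ (Fin 3)} (hs₀ : s₀ ∈ fccSlots)
    (hcert : ExactOnly 0 (fccSlots.filter fun w => 0 < ⟪w, s₀⟫_ℝ)) (hfar : StarPairFar)
    (hcore : CoaxialTwoSlabAdhesionTriadic) :
    Summit.Ventures.Crystal3D.Theses.StickyWulffConstant.CoaxialWallLaw :=
  coaxialWallLaw_of_stubProps Summit.Ventures.Crystal3D.Theorems.stub_affineSampleDeficit
    (coaxialTwoSlabAdhesion_of_triadic hs₀ hcert hfar hcore)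

/-- **The crux `CoaxialWallLaw` BY NAME from `P5Exhaustion` (E1), `StarPairFar` and the triadic core.** -/
theorem coaxialWallLaw_of_p5_triadic (hE1 : P5Exhaustion) (hfar : StarPairFar)
    (hcore : CoaxialTwoSlabAdhesionTriadic) :
    Summit.Ventures.Crystal3D.Theses.StickyWulffConstant.CoaxialWallLaw := by
  obtain ⟨s₀, hs₀, hcert⟩ := exactOnly_star_of_p5Exhaustion hE1
  exact coaxialWallLaw_of_triadic hs₀ hcert hfar hcore

end Summit.Ventures.Crystal3D.Theorems

end
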